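import Literature.Geometry.Lorentzian.NearKerrLeaf
import HarnessLib

/-!
# The collar margin of a spacetime (summit `FinalStateConjecture`, route `BartnikGapSettling`)

The **collar margin** `Spacetime.CollarMargin 𝓢` wanted by route `BartnikGapSettling` of the
summit `FinalStateConjecture` (work item `defn-CollarMargin`): the near-horizon, late-time,
*uniform sub-extremality* clause

> there are `χ₁ < 1`, `k₁ : ℕ`, `δ₁ > 0` and a compact `K₁ ⊆ 𝓢` such that every **thick collar
> chart** `Φ₁` modelled on boosted Kerr `(M₁, a₁)` (`0 < M₁`, `|a₁| ≤ M₁`) which is `δ₁`-close in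
> `C^{k₁}` to Kerr on its collar slab and whose collar slab lies beyond `J⁻(K₁)` has
> `|a₁| ≤ χ₁ · M₁`,

shared VERBATIM by two items of that route — it is a *hypothesis* of the crux `GapExhaustion`
(stmt-FinalStateConjecture-10808) and the second conjunct of the *conclusion* of the crux
`GenericCensorshipCollarMargin` (stmt-FinalStateConjecture-10809) of
`Summits/FinalStateConjecture/FinalStateConjecture/Theses/BartnikGapSettling.lean` — recorded here
once so that both items can be restated over it with identical meaning.

## The thick collar chart (vocabulary of `NearKerrLeaf` / `KerrConvergence`)

A thick collar chart of parameters `(M₁, a₁)` and motion `mo₁ = (Λ, c) : lorentzGroup × E4` is a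
map `Φ₁ : B₁.domain → 𝓢.carrier` on the boosted Kerr STAR background
`B₁ = starBackground Λ c M₁ a₁ (x ↦ r_{a₁}(Λ⁻¹(x − c)))` (domain the star region `{r > M₁}`,
Kerr-star time `t*`, boosted Kerr–Schild radius `r`; `NearKerrLeaf.lean`), which is smooth on and
an open topological embedding of the **collar layer** `{−1 < t* < 1, r < 3M₁ + 1}`, and whose
pulled-back metric is `δ₁`-close in `C^{k₁}` to the boosted Kerr–Schild form on the **thick
collar slab** `B₁.truncTimeSlab (3M₁) 0 = {t* = 0, M₁ < r ≤ 3M₁}`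
(`Spacetime.truncDeviationCk … k₁ (3M₁) 0 ≤ δ₁`). Since `r₋ ≤ M₁ ≤ r₊ ≤ 2M₁ ≤ 3M₁` the slab is
horizon-penetrating and contains the ergoregion and a strictly stationary shell — whence
"thick collar" (of the horizon). "Late" is rendered without `𝓘⁺`: the slab image is disjoint
from the causal past `J⁻(K₁)` of a compact set.

## Design

* The clause uses only the time-oriented Lorentzian structure `(carrier, g, τ)` of the
  development (`J⁻` and `truncDeviationCk`), so it is defined for `𝓢 : Spacetime 4`; for a
  (vacuum) Cauchy development `𝒟` one writes `𝒟.CollarMargin`, dot notation resolving through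
  the `extends` chain `VacuumCauchyDevelopment → CauchyDevelopment → DataEmbedding → Spacetime`
  to `Spacetime.CollarMargin 𝒟.toSpacetime`.
* The quantified clause is named separately, `Spacetime.HasCollarMargin 𝓢 χ₁ k₁ δ₁ K₁`
  ("`(χ₁, k₁, δ₁, K₁)` is a collar-margin datum"), and
  `CollarMargin 𝓢 := ∃ χ₁ k₁ δ₁ K₁, χ₁ < 1 ∧ 0 < δ₁ ∧ IsCompact K₁ ∧ HasCollarMargin …`; the body
  of `HasCollarMargin` is the filed text verbatim (binder names, binder order, the equational
  binder `B₁ = starBackground …`, the curried hypotheses), so that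
  `𝒟.CollarMargin ↔ ⟨the inlined clause of the two items⟩` is `Iff.rfl` (delta-unfolding only;
  checked against the gate-written Theses file in the session's scratch file, which Literature
  cannot import, CONVENTIONS §2). `collarMargin_iff` records the unfolded form.
* API (all proved): monotonicity of `HasCollarMargin` — up in `χ₁`, `k₁`, `K₁`, down in `δ₁`
  (`HasCollarMargin.mono`, via `supCkENorm_mono_right` and monotonicity of `J⁻`); the datum is
  vacuous for `χ₁ ≥ 1` (`hasCollarMargin_of_one_le`: the conclusion is then implied by the
  hypothesis `|a₁| ≤ M₁`, so the content of `CollarMargin` is exactly the constraint `χ₁ < 1`);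
  normalisations of the witnesses of `CollarMargin` (`0 ≤ χ₁`, `K₁ ⊇` any given compact set,
  `k₁ ≥` any given order, `δ₁ ≤` any given positive size); and the pointwise reading
  `CollarMargin.isSubextremal`: every late thick near-Kerr collar is strictly sub-extremal,
  `Kerr.IsSubextremal M₁ a₁`.

## Sources and status

The predicate has NO printed formulation: it is posited by the route (planner
`planner-plancard-FinalStateConjecture-FinalSt-091519c0-0`, 2026-08-15) as "the generic third
law of black-hole mechanics in near-horizon form", and nothing is asserted about it here. What
the literature prints, and why the clause has this shape:

* Dafermos–Luk, arXiv:1710.01722, Conjecture 1(c) (nonlinear stability of the Kerr exterior):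
  the development of data close to sub-extremal Kerr approaches, in `J⁻(𝓘⁺)`, a Kerr metric with
  nearby parameters `0 ≤ |aᵢ| < Mᵢ`; and §1.2.1, the "more ambitious conjecture" that generic
  asymptotically flat vacuum data disperse or settle down to finitely many Kerr black holes
  moving apart (pp. 7–8 of the arXiv version). Sub-extremality `|a| < M` of the LIMIT is what a
  margin `χ₁ < 1` makes uniform along the approach.
* Bardeen–Carter–Hawking, CMP 31 (1973): the third law ("`κ → 0` is not reached in finite
  advanced time"). Kehle–Unger, JEMS (2025) = arXiv:2211.15742, Thm. 1: the third law is FALSE —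
  regular one-ended data for the Einstein–Maxwell-charged scalar field system form an exactly
  Schwarzschild apparent horizon and later an exactly extremal Reissner–Nordström event
  horizon; §1, Conjecture: the same in vacuum with extremal Kerr; §1.4.5: stability at any fixed
  parameter ratio, up to extremality, is a positive-codimension statement. Hence a collar margin
  can at best hold for GENERIC data, which is how item `GenericCensorshipCollarMargin` states it.
* Aretakis, ATMP 19 (2015): extremal horizons carry a linear (horizon) instability — no
  red-shift — which is why capture/stability arguments consume a uniform bound `|a| ≤ χM`,
  `χ < 1`, rather than `|a| < M` chart by chart.
* Chart/deviation vocabulary in consequence form: Dafermos–Holzegel–Rodnianski–Taylor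
  arXiv:2104.08222, §1 (as in `KerrConvergence`, `NearKerrLeaf`); Kerr-star slabs `{t* = τ}`:
  Dafermos–Rodnianski arXiv:0811.0354, §5.1.

## Mathlib

No Lorentzian geometry in Mathlib; used are `IsCompact`, `Disjoint`, `ContMDiffOn`,
`Topology.IsOpenEmbedding`, `Set.restrict`, `ℝ≥0∞`.

## Not here

No spacetime is shown to have, or to lack, a collar margin (either direction has analytic
content: producing or excluding near-Kerr thick collars); no relation to surface gravity or to
trapped surfaces (the printed third-law vocabulary) is formalised; the `N`-chart collar block
`NearKerrCollarCore` and the gap functional `BondiBartnikGapLE` of the same route are separate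
work items.
-/

noncomputable section

open Set TopologicalSpace Filter Topology
open scoped Manifold ContDiff Topology ENNReal

universe u

namespace Literature.Geometry.Lorentzian

namespace Spacetime

/-- **`(χ₁, k₁, δ₁, K₁)` is a collar-margin datum for the spacetime `𝓢`** (route-posited clause
of route `BartnikGapSettling`, summit `FinalStateConjecture`; verbatim the quantified part of the
clause inlined in its items `GapExhaustion` / `GenericCensorshipCollarMargin`): for all
parameters `0 < M₁`, `|a₁| ≤ M₁`, every motion `mo₁ = (Λ, c)`, and every chart
`Φ₁ : B₁.domain → 𝓢` on the boosted Kerr star background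
`B₁ = starBackground Λ c M₁ a₁ (x ↦ r_{a₁}(Λ⁻¹(x − c)))` which is smooth on the collar layer
`{−1 < t* < 1, r < 3M₁ + 1}`, an open embedding of that layer, `δ₁`-close in `C^{k₁}` to boosted
Kerr on the thick collar slab `{t* = 0, r ≤ 3M₁}` (`truncDeviationCk … k₁ (3M₁) 0 ≤ δ₁`), and
LATE in the sense that the image of the collar slab is disjoint from `J⁻(K₁)` — the spin obeys
the uniform bound `|a₁| ≤ χ₁ · M₁`. Meaningful for `χ₁ < 1` only (`hasCollarMargin_of_one_le`).
Nearest printed statement: the final Kerr parameters are sub-extremal, `0 ≤ |aᵢ| < Mᵢ`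
(Dafermos–Luk arXiv:1710.01722, Conjecture 1(c)); the clause itself is not in print.
[cite: DafermosLuk2017, Conjecture 1] -/
def HasCollarMargin (𝓢 : Spacetime.{u} 4) (χ₁ : ℝ) (k₁ : ℕ) (δ₁ : ℝ≥0∞) (K₁ : Set 𝓢.carrier) :
    Prop :=
  ∀ (M₁ a₁ : ℝ) (mo₁ : lorentzGroup × E4) (B₁ : ModelBackground) (Φ₁ : B₁.domain → 𝓢.carrier),
    0 < M₁ → |a₁| ≤ M₁ →
    B₁ = starBackground mo₁.1 mo₁.2 M₁ a₁ (fun x => Kerr.radius a₁ (poincareInv mo₁.1 mo₁.2 x)) →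
    ContMDiffOn 𝓘(ℝ, E4) (𝓡 4) ∞ Φ₁
        {x | -1 < B₁.time x.1 ∧ B₁.time x.1 < 1 ∧ B₁.radius x.1 < 3 * M₁ + 1} →
    IsOpenEmbedding
        ({x | -1 < B₁.time x.1 ∧ B₁.time x.1 < 1 ∧ B₁.radius x.1 < 3 * M₁ + 1}.restrict Φ₁) →
    𝓢.truncDeviationCk B₁ Φ₁ k₁ (3 * M₁) 0 ≤ δ₁ →
    Disjoint (Φ₁ '' B₁.truncTimeSlab (3 * M₁) 0) (𝓢.metric.causalPast 𝓢.timeOrientation K₁) →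
    |a₁| ≤ χ₁ * M₁

/-- **The spacetime `𝓢` has a collar margin** (route-posited notion of route
`BartnikGapSettling`, summit `FinalStateConjecture`; for a Cauchy development `𝒟` write
`𝒟.CollarMargin`, and then `𝒟.CollarMargin ↔ ⟨the clause inlined in the items GapExhaustion /
GenericCensorshipCollarMargin⟩` holds by `Iff.rfl`): there are a ratio `χ₁ < 1`, an order
`k₁`, a size `0 < δ₁` and a compact `K₁ ⊆ 𝓢` forming a collar-margin datum
(`HasCollarMargin`) — late thick near-Kerr horizon collars are UNIFORMLY sub-extremal,
`|a₁| ≤ χ₁ M₁`. The near-horizon, generic form of the third law of black-hole mechanics the route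
consumes; the third law itself is false (Kehle–Unger, JEMS 2025, Thm. 1), so routes assert this
only for generic data. Nearest printed statement: Dafermos–Luk arXiv:1710.01722,
Conjecture 1(c) (`0 ≤ |aᵢ| < Mᵢ` for the final parameters). [cite: DafermosLuk2017, Conjecture 1] -/
def CollarMargin (𝓢 : Spacetime.{u} 4) : Prop :=
  ∃ (χ₁ : ℝ) (k₁ : ℕ) (δ₁ : ℝ≥0∞) (K₁ : Set 𝓢.carrier),
    χ₁ < 1 ∧ 0 < δ₁ ∧ IsCompact K₁ ∧ 𝓢.HasCollarMargin χ₁ k₁ δ₁ K₁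

/-- Unfolding lemma: `CollarMargin` is, by `Iff.rfl`, the clause filed in the items
`GapExhaustion` / `GenericCensorshipCollarMargin` of route `BartnikGapSettling` (with `𝒟.carrier`,
`𝒟.toSpacetime.truncDeviationCk`, `𝒟.metric.causalPast 𝒟.timeOrientation` for a development
`𝒟`, all of which are projections to `𝒟.toSpacetime`). [folklore] -/
theorem collarMargin_iff (𝓢 : Spacetime.{u} 4) :
    𝓢.CollarMargin ↔
      ∃ (χ₁ : ℝ) (k₁ : ℕ) (δ₁ : ℝ≥0∞) (K₁ : Set 𝓢.carrier), χ₁ < 1 ∧ 0 < δ₁ ∧ IsCompact K₁ ∧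
        ∀ (M₁ a₁ : ℝ) (mo₁ : lorentzGroup × E4) (B₁ : ModelBackground)
          (Φ₁ : B₁.domain → 𝓢.carrier), 0 < M₁ → |a₁| ≤ M₁ →
          B₁ = starBackground mo₁.1 mo₁.2 M₁ a₁
            (fun x => Kerr.radius a₁ (poincareInv mo₁.1 mo₁.2 x)) →
          ContMDiffOn 𝓘(ℝ, E4) (𝓡 4) ((⊤ : ℕ∞) : WithTop ℕ∞) Φ₁
            {x | -1 < B₁.time x.1 ∧ B₁.time x.1 < 1 ∧ B₁.radius x.1 < 3 * M₁ + 1} →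
          Topology.IsOpenEmbedding
            ({x | -1 < B₁.time x.1 ∧ B₁.time x.1 < 1 ∧ B₁.radius x.1 < 3 * M₁ + 1}.restrict Φ₁) →
          𝓢.truncDeviationCk B₁ Φ₁ k₁ (3 * M₁) 0 ≤ δ₁ →
          Disjoint (Φ₁ '' B₁.truncTimeSlab (3 * M₁) 0)
            (𝓢.metric.causalPast 𝓢.timeOrientation K₁) →
          |a₁| ≤ χ₁ * M₁ :=
  Iff.rfl

variable {𝓢 : Spacetime.{u} 4}

namespace HasCollarMargin

variable {χ₁ χ₁' : ℝ} {k₁ k₁' : ℕ} {δ₁ δ₁' : ℝ≥0∞} {K₁ K₁' : Set 𝓢.carrier}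

/-- **Monotonicity of collar-margin data.** A datum `(χ₁, k₁, δ₁, K₁)` remains one after
raising the ratio `χ₁ ≤ χ₁'` (masses are positive), raising the order `k₁ ≤ k₁'` (`Cᵏ` sup norms
are monotone in `k`, `supCkENorm_mono_right`), shrinking the size `δ₁' ≤ δ₁`, and enlarging the
compact set `K₁ ⊆ K₁'` (`J⁻` is monotone, O'Neill 1983, Ch. 14, p. 402, time-dually): each
change only restricts the class of charts the clause speaks about or weakens its conclusion.
[folklore] -/
theorem mono (h : 𝓢.HasCollarMargin χ₁ k₁ δ₁ K₁) (hχ : χ₁ ≤ χ₁') (hk : k₁ ≤ k₁')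
    (hδ : δ₁' ≤ δ₁) (hK : K₁ ⊆ K₁') : 𝓢.HasCollarMargin χ₁' k₁' δ₁' K₁' := by
  intro M₁ a₁ mo₁ B₁ Φ₁ hM ha hB hsm hemb hdev hdisj
  have hJ : 𝓢.metric.causalPast 𝓢.timeOrientation K₁ ⊆
      𝓢.metric.causalPast 𝓢.timeOrientation K₁' :=
    LorentzianMetric.causalFuture_mono hK
  have h₁ : |a₁| ≤ χ₁ * M₁ :=
    h M₁ a₁ mo₁ B₁ Φ₁ hM ha hB hsm hemb (((supCkENorm_mono_right _ hk _).trans hdev).trans hδ)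
      (hdisj.mono_right hJ)
  exact h₁.trans (mul_le_mul_of_nonneg_right hχ hM.le)

/-- Monotonicity in the ratio alone. [folklore] -/
theorem of_le (h : 𝓢.HasCollarMargin χ₁ k₁ δ₁ K₁) (hχ : χ₁ ≤ χ₁') :
    𝓢.HasCollarMargin χ₁' k₁ δ₁ K₁ :=
  h.mono hχ le_rfl le_rfl Subset.rfl

/-- Monotonicity in the compact set alone (a later cut sees fewer collars). [folklore] -/
theorem of_subset (h : 𝓢.HasCollarMargin χ₁ k₁ δ₁ K₁) (hK : K₁ ⊆ K₁') :
    𝓢.HasCollarMargin χ₁ k₁ δ₁ K₁' :=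
  h.mono le_rfl le_rfl le_rfl hK

/-- **Pointwise reading.** Under a collar-margin datum with `χ₁ < 1`, every late thick
near-Kerr collar chart has strictly sub-extremal parameters, `|a₁| < M₁`
(`Kerr.IsSubextremal`; Dafermos–Luk arXiv:1710.01722, Conjecture 1(c): `0 ≤ |aᵢ| < Mᵢ`).
[cite: DafermosLuk2017, Conjecture 1] -/
theorem isSubextremal (h : 𝓢.HasCollarMargin χ₁ k₁ δ₁ K₁) (hχ₁ : χ₁ < 1) {M₁ a₁ : ℝ}
    {mo₁ : lorentzGroup × E4} {B₁ : ModelBackground} {Φ₁ : B₁.domain → 𝓢.carrier}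
    (hM : 0 < M₁) (ha : |a₁| ≤ M₁)
    (hB : B₁ = starBackground mo₁.1 mo₁.2 M₁ a₁
      (fun x => Kerr.radius a₁ (poincareInv mo₁.1 mo₁.2 x)))
    (hsm : ContMDiffOn 𝓘(ℝ, E4) (𝓡 4) ∞ Φ₁
      {x | -1 < B₁.time x.1 ∧ B₁.time x.1 < 1 ∧ B₁.radius x.1 < 3 * M₁ + 1})
    (hemb : IsOpenEmbedding
      ({x | -1 < B₁.time x.1 ∧ B₁.time x.1 < 1 ∧ B₁.radius x.1 < 3 * M₁ + 1}.restrict Φ₁))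
    (hdev : 𝓢.truncDeviationCk B₁ Φ₁ k₁ (3 * M₁) 0 ≤ δ₁)
    (hdisj : Disjoint (Φ₁ '' B₁.truncTimeSlab (3 * M₁) 0)
      (𝓢.metric.causalPast 𝓢.timeOrientation K₁)) :
    Kerr.IsSubextremal M₁ a₁ := by
  have h₁ : |a₁| ≤ χ₁ * M₁ := h M₁ a₁ mo₁ B₁ Φ₁ hM ha hB hsm hemb hdev hdisj
  have h₂ : χ₁ * M₁ < 1 * M₁ := mul_lt_mul_of_pos_right hχ₁ hM
  rw [one_mul] at h₂
  exact h₁.trans_lt h₂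

end HasCollarMargin

/-- **The ratio `χ₁ = 1` is free.** Every `(1, k₁, δ₁, K₁)` is a collar-margin datum of every
spacetime, because the clause carries the hypothesis `|a₁| ≤ M₁`: the content of `CollarMargin`
is exactly the constraint `χ₁ < 1` (uniform SUB-extremality, as opposed to the non-strict
`|a| ≤ M` of `FinalStateDecomposition.abs_spin_le_mass`). [folklore] -/
theorem hasCollarMargin_one (k₁ : ℕ) (δ₁ : ℝ≥0∞) (K₁ : Set 𝓢.carrier) :
    𝓢.HasCollarMargin 1 k₁ δ₁ K₁ := by
  intro M₁ a₁ _ _ _ _ ha _ _ _ _ _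
  rwa [one_mul]

/-- Every ratio `χ₁ ≥ 1` gives a (vacuous) collar-margin datum. [folklore] -/
theorem hasCollarMargin_of_one_le {χ₁ : ℝ} (hχ₁ : 1 ≤ χ₁) (k₁ : ℕ) (δ₁ : ℝ≥0∞)
    (K₁ : Set 𝓢.carrier) : 𝓢.HasCollarMargin χ₁ k₁ δ₁ K₁ :=
  (hasCollarMargin_one k₁ δ₁ K₁).of_le hχ₁

namespace CollarMargin

/-- **Normalised witnesses.** If `𝓢` has a collar margin then, given any compact `K`, any order
`k` and any size `δ > 0`, there is a collar-margin datum `(χ₁, k₁, δ₁, K₁)` with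
`0 ≤ χ₁ < 1`, `k ≤ k₁`, `0 < δ₁ ≤ δ`, and `K ⊆ K₁` compact: raise `χ₁` to `max χ₁ 0` and `k₁` to
`max k₁ k`, shrink `δ₁` to `min δ₁ δ`, enlarge `K₁` to `K₁ ∪ K` (`HasCollarMargin.mono`). This is
the form in which a route combines the margin with other "sufficiently late / sufficiently
close" requirements. [folklore] -/
theorem exists_normalised (h : 𝓢.CollarMargin) {K : Set 𝓢.carrier} (hK : IsCompact K) (k : ℕ)
    {δ : ℝ≥0∞} (hδ : 0 < δ) :
    ∃ (χ₁ : ℝ) (k₁ : ℕ) (δ₁ : ℝ≥0∞) (K₁ : Set 𝓢.carrier), 0 ≤ χ₁ ∧ χ₁ < 1 ∧ k ≤ k₁ ∧ 0 < δ₁ ∧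
      δ₁ ≤ δ ∧ IsCompact K₁ ∧ K ⊆ K₁ ∧ 𝓢.HasCollarMargin χ₁ k₁ δ₁ K₁ := by
  obtain ⟨χ₁, k₁, δ₁, K₁, hχ₁, hδ₁, hK₁, hm⟩ := h
  exact ⟨max χ₁ 0, max k₁ k, min δ₁ δ, K₁ ∪ K, le_max_right _ _, max_lt hχ₁ one_pos,
    le_max_right _ _, lt_min hδ₁ hδ, min_le_right _ _, hK₁.union hK, subset_union_right,
    hm.mono (le_max_left _ _) (le_max_left _ _) (min_le_left _ _) subset_union_left⟩

/-- A collar margin may be taken with a non-negative ratio `0 ≤ χ₁ < 1`. [folklore] -/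
theorem exists_nonneg (h : 𝓢.CollarMargin) :
    ∃ (χ₁ : ℝ) (k₁ : ℕ) (δ₁ : ℝ≥0∞) (K₁ : Set 𝓢.carrier), 0 ≤ χ₁ ∧ χ₁ < 1 ∧ 0 < δ₁ ∧
      IsCompact K₁ ∧ 𝓢.HasCollarMargin χ₁ k₁ δ₁ K₁ := by
  obtain ⟨χ₁, k₁, δ₁, K₁, h0, hχ₁, -, hδ₁, -, hK₁, -, hm⟩ :=
    h.exists_normalised isCompact_empty 0 ENNReal.zero_lt_top
  exact ⟨χ₁, k₁, δ₁, K₁, h0, hχ₁, hδ₁, hK₁, hm⟩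

/-- **Pointwise reading of the collar margin.** If `𝓢` has a collar margin, then beyond the
causal past of some compact set every thick collar chart close enough (`δ₁` in `C^{k₁}`) to
boosted Kerr `(M₁, a₁)` has `Kerr.IsSubextremal M₁ a₁`, i.e. `|a₁| < M₁` — the printed
expectation `0 ≤ |aᵢ| < Mᵢ` for final Kerr parameters (Dafermos–Luk arXiv:1710.01722,
Conjecture 1(c)), chart by chart. [cite: DafermosLuk2017, Conjecture 1] -/
theorem isSubextremal (h : 𝓢.CollarMargin) :
    ∃ (k₁ : ℕ) (δ₁ : ℝ≥0∞) (K₁ : Set 𝓢.carrier), 0 < δ₁ ∧ IsCompact K₁ ∧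
      ∀ (M₁ a₁ : ℝ) (mo₁ : lorentzGroup × E4) (B₁ : ModelBackground)
        (Φ₁ : B₁.domain → 𝓢.carrier), 0 < M₁ → |a₁| ≤ M₁ →
        B₁ = starBackground mo₁.1 mo₁.2 M₁ a₁
          (fun x => Kerr.radius a₁ (poincareInv mo₁.1 mo₁.2 x)) →
        ContMDiffOn 𝓘(ℝ, E4) (𝓡 4) ∞ Φ₁
          {x | -1 < B₁.time x.1 ∧ B₁.time x.1 < 1 ∧ B₁.radius x.1 < 3 * M₁ + 1} →
        IsOpenEmbedding
          ({x | -1 < B₁.time x.1 ∧ B₁.time x.1 < 1 ∧ B₁.radius x.1 < 3 * M₁ + 1}.restrict Φ₁) →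
        𝓢.truncDeviationCk B₁ Φ₁ k₁ (3 * M₁) 0 ≤ δ₁ →
        Disjoint (Φ₁ '' B₁.truncTimeSlab (3 * M₁) 0)
          (𝓢.metric.causalPast 𝓢.timeOrientation K₁) →
        Kerr.IsSubextremal M₁ a₁ := by
  obtain ⟨χ₁, k₁, δ₁, K₁, hχ₁, hδ₁, hK₁, hm⟩ := h
  exact ⟨k₁, δ₁, K₁, hδ₁, hK₁, fun M₁ a₁ mo₁ B₁ Φ₁ hM ha hB hsm hemb hdev hdisj =>
    hm.isSubextremal hχ₁ hM ha hB hsm hemb hdev hdisj⟩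

end CollarMargin

/-- A spacetime has a collar margin as soon as it carries a collar-margin datum with SOME ratio
`χ₁ < 1`, some order, some positive size and some compact set (constructor, restated for
dot-free use). [folklore] -/
theorem collarMargin_of_hasCollarMargin {χ₁ : ℝ} {k₁ : ℕ} {δ₁ : ℝ≥0∞} {K₁ : Set 𝓢.carrier}
    (hχ₁ : χ₁ < 1) (hδ₁ : 0 < δ₁) (hK₁ : IsCompact K₁) (h : 𝓢.HasCollarMargin χ₁ k₁ δ₁ K₁) :
    𝓢.CollarMargin :=
  ⟨χ₁, k₁, δ₁, K₁, hχ₁, hδ₁, hK₁, h⟩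

end Spacetime

end Literature.Geometry.Lorentzian

end
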